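import Summits.AtomisticToContinuum.Crystallization.Theorems.ExcessDecayLiouvillePhononStabilityFarDefs

/-!
# `PhononStability` (stmt-AtomisticToContinuum-9333), line `contragredient-window-collapse` (lead c2): the near certificate ON THE IN-PLANE FUNDAMENTAL DOMAIN

Vocabulary extension for the reshaped skeleton v8.  By the lattice symmetry of the crux
(`Theorems/ExcessDecayLiouvillePhononStabilityCertSymm.lean`: a lattice isometry re-describes an admissible datum with the same
site set; `…CertSymmHcp.lean`: the basal mirrors order the three in-plane nearest-neighbour stretches), the near certificate of the
line is only needed for data whose in-plane stretches are ORDERED, `‖A u‖ ≤ ‖A v‖ ≤ ‖A (u − v)‖` — one sixth of the strain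
window.  `NearCertificateF` is `NearCertificate` (`…FarDefs.lean`) with this extra hypothesis; it is the stub statement
`stub_nearF` of skeleton v8 (vertex scheme: a grid of nodes over the fundamental domain, one positive-semidefiniteness check per
node, the vertex interpolation lemma in between).  `[folklore]` bookkeeping of this line; nothing here closes an item.
-/

noncomputable section

open scoped BigOperators Classical InnerProductSpace
open Filter Set Function
open Literature.MathematicalPhysics.StatisticalMechanics
open Summit.AtomisticToContinuum.Crystallization.Theses.ExcessDecayLiouville
open Summit.AtomisticToContinuum.Crystallization.Theorems.PhononStabilityNegative

namespace Summit.AtomisticToContinuum.Crystallization.Theorems.PhononStabilityCWC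

local notation "E3" => EuclideanSpace ℝ (Fin 3)

/-- The in-plane nearest-neighbour stretches of the cell matrix are ORDERED: `‖A u‖ ≤ ‖A v‖ ≤ ‖A (u − v)‖`
(the fundamental domain of the basal mirrors). [folklore] -/
def StretchOrdered (A : E3 →L[ℝ] E3) : Prop := ‖A genU‖ ≤ ‖A genV‖ ∧ ‖A genV‖ ≤ ‖A (genU - genV)‖

/-- **S11-F — NEAR CERTIFICATE ON THE FUNDAMENTAL DOMAIN** (the transfer target of the reshaped line v8; computational):
`NearCertificate` with the extra hypothesis `StretchOrdered A`.  For some `κ > 0` and ranges `2 ≤ Rn ≤ Rf ≤ R∞`, `R∞ ≥ 100`,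
with a valid chain assignment and a mid-range assignment, the EXACT finite-range form dominates `2κ·Σ_nn metricForm` plus the
three far charges, uniformly on the window ∩ fundamental domain (proved by a grid of positive-semidefiniteness checks at nodes
and the vertex interpolation lemma on the cells of the grid). -/
def NearCertificateF : Prop :=
  ∃ κ : ℝ, 0 < κ ∧ ∃ (Rn Rf Rinf : ℝ) (chain : BondClass → List BondClass) (P : BondClass → ℝ),
    2 ≤ Rn ∧ Rn ≤ Rf ∧ Rf ≤ Rinf ∧ 100 ≤ Rinf ∧ ValidChains Rn Rf chain ∧ MidBound Rf Rinf P ∧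
    ∀ (A B : E3 →L[ℝ] E3) (δ : E3) (w : Label → E3), CellWindow A → ShiftWindow A δ → Contragredient A B →
      StretchOrdered A → (Function.support w).Finite →
        2 * κ * (∑ c ∈ nnClasses, metricForm B c w) + chargeSum Rn Rf chain A δ w
            + (∑ c ∈ farClasses Rf Rinf, farCoeff c * P c) * N0 w + 40000 / Rinf ^ 3 * N0 w
          ≤ ∑ c ∈ classesR Rn, classTerm A B δ w c

/-- The full near certificate implies the one on the fundamental domain. [folklore] -/
theorem nearCertificateF_of_nearCertificate (h : NearCertificate) : NearCertificateF := by
  obtain ⟨κ, hκ, Rn, Rf, Rinf, chain, P, h1, h2, h3, h4, h5, h6, h7⟩ := h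
  exact ⟨κ, hκ, Rn, Rf, Rinf, chain, P, h1, h2, h3, h4, h5, h6,
    fun A B δ w hW hδ hAB _ hw => h7 A B δ w hW hδ hAB hw⟩

/-- Registered anchor of this vocabulary file (`stub_vtxDefs`): the ordering predicate at the zero matrix. [folklore] -/
theorem stub_vtxDefs : StretchOrdered 0 := by
  unfold StretchOrdered; simp

end Summit.AtomisticToContinuum.Crystallization.Theorems.PhononStabilityCWC

end
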